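import Summits.CriticalPhenomena.PercolationContinuityZ3.Theorems.SahiBoxTP2Coupling
import Mathlib.Probability.Kernel.Disintegration.Unique

/-!
# Conditionally increasing in sequence WITHOUT densities: the almost-everywhere kernel notion and the standard
# construction (every dimension)

Cell `prim-sahi`, typer (generation 17); `--supports stmt-CriticalPhenomena-4575`.  No sorries, no named facts.

Classically (Müller–Stoyan, *Comparison Methods for Stochastic Models and Risks*, Def. 3.10.9 / Lemma 3.10.10) a
random vector `(X₁,…,X_d)` is CIS if each conditional law `L(X_k | X₁,…,X_{k−1})` is stochastically increasing in
the conditioning vector — a statement about VERSIONS of conditional distributions.  Colangelo–Müller–Scarsini (2006,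
§4) proposed a density-free cylinder criterion (Definition 4), which in dimension `≥ 3` is strictly too weak
(`SahiCISDefinitionFour.lean`: it ignores conditioning points sharing a coordinate; Theorem 4 (a) ⇒ (b) fails as
printed).  This file gives the version-free notion that does work, on the unit cube `Q_d = (Fin d → [0,1])`:

* `AEPairMonoKernel ν κ` — a Markov kernel `κ : α → [0,1]` is stochastically increasing on `ν ⊗ ν`-ALMOST EVERY
  comparable PAIR: `a ≤ b ⇒ κ_b([0,x]) ≤ κ_a([0,x])` for all `x`, off a `ν ⊗ ν`-null set of pairs.  This is
  independent of the version (`AEPairMonoKernel.congr_ae`), implied by monotonicity on a full-measure set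
  (`.of_monotoneOn`) and a fortiori by everywhere monotonicity (`.of_forall`).
* `IsCISae d μ` — **CIS in the a.e.-kernel sense** for a finite measure on `Q_d`, by recursion on `d`: the law of the
  first `d` coordinates is `IsCISae d`, and the last coordinate admits a disintegration kernel over it that is
  `AEPairMonoKernel` (equivalently — kernels being a.e. unique — the canonical `condKernel` is:
  `isCISae_succ_iff_condKernel`).
* `exists_aepairmono_map_compProd`, **`IsCISae.exists_aepairmono_coupling`** — THE STANDARD CONSTRUCTION: an
  `IsCISae` probability law on `Q_d` is `G_* λ_d` for a Borel map `G : Q_d → Q_d` that is monotone on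
  `λ_d ⊗ λ_d`-almost every comparable pair (`AEPairMono`).  (Fibrewise quantiles of the kernels, by induction on
  `d`, as in `SahiBoxTP2Coupling.lean` with "monotone on a full-measure set" weakened to "on almost every pair".)
  The companion `SahiCISMonotoneVersion.lean` upgrades `G` to an everywhere-monotone Borel map (Lebesgue density on
  the cube), whence positive association and Sahi positivity (`SahiCISPositivity.lean`).
* Sources: `IsBoxTP2.isCISae` — every box-TP₂ law (cell-FKG / MTP₂ without densities, `SahiBoxTP2*.lean`) is
  `IsCISae` (the Besicovitch kernel of `SahiBoxTP2Kernel.exists_aeCisKernel`); `isCISae_succ_of_kernel` — appending a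
  coordinate through an (a.e.-pair) stochastically increasing kernel.

References: Müller–Stoyan 2002, Def. 3.10.9, Lemma 3.10.10, Thm. 3.10.11 [MullerStoyan2002]; Colangelo–Müller–Scarsini,
J. Appl. Probab. 43 (2006) 48–59, §4 Thm. 4 [ColangeloMullerScarsini2006]; Rüschendorf 1981 / Rubinstein–Samorodnitsky–
Shaked 1985 (standard construction).  The a.e.-pair notion and the singular-law statements are this work.
-/

noncomputable section

namespace Summit.CriticalPhenomena.PercolationContinuityZ3.Theorems.SahiCIS

open MeasureTheory ProbabilityTheory Set Filter Topology Function
open Summit.CriticalPhenomena.PercolationContinuityZ3.Theorems.SahiBoxTP2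
open scoped ENNReal unitInterval

/-! ### Null sets of pairs -/

section Pairs

variable {α β : Type*} [MeasurableSpace α] [MeasurableSpace β]

/-- If `S` has full `μ`-measure then `μ ⊗ ν`-almost every pair has its first component in `S`. [folklore] -/
theorem ae_prod_fst_mem {μ : Measure α} {ν : Measure β} [SFinite ν] {S : Set α} (hS : ∀ᵐ x ∂μ, x ∈ S) :
    ∀ᵐ p ∂(μ.prod ν), p.1 ∈ S := by
  rw [ae_iff] at hS ⊢
  have hset : {p : α × β | ¬ p.1 ∈ S} = {x | ¬ x ∈ S} ×ˢ (univ : Set β) := by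
    ext p; simp
  rw [hset, Measure.prod_prod, hS, zero_mul]

/-- If `S` has full `ν`-measure then `μ ⊗ ν`-almost every pair has its second component in `S`. [folklore] -/
theorem ae_prod_snd_mem {μ : Measure α} {ν : Measure β} [SFinite ν] {S : Set β} (hS : ∀ᵐ y ∂ν, y ∈ S) :
    ∀ᵐ p ∂(μ.prod ν), p.2 ∈ S := by
  rw [ae_iff] at hS ⊢
  have hset : {p : α × β | ¬ p.2 ∈ S} = (univ : Set α) ×ˢ {y | ¬ y ∈ S} := by
    ext p; simp
  rw [hset, Measure.prod_prod, hS, mul_zero]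

/-- Pull-back of an a.e. statement on pairs along a product map. [folklore] -/
theorem ae_prod_comp_of_ae_prod_map {γ δ : Type*} [MeasurableSpace γ] [MeasurableSpace δ]
    {μ : Measure α} {ν : Measure β} [SFinite μ] [SFinite ν] {f : α → γ} {g : β → δ}
    (hf : Measurable f) (hg : Measurable g) {P : γ × δ → Prop}
    (h : ∀ᵐ q ∂((μ.map f).prod (ν.map g)), P q) :
    ∀ᵐ p ∂(μ.prod ν), P (f p.1, g p.2) := by
  rw [Measure.map_prod_map μ ν hf hg] at h
  exact ae_of_ae_map (hf.prodMap hg).aemeasurable h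

end Pairs

/-! ### Almost-every-pair monotonicity of maps and kernels -/

section Defs

variable {Ω β γ : Type*} [MeasurableSpace Ω]

/-- A map `G` is **monotone on almost every pair** (w.r.t. `μ`): `x ≤ y ⇒ G x ≤ G y` off a `μ ⊗ μ`-null set of
pairs `(x, y)`. [this work] -/
def AEPairMono [Preorder Ω] [Preorder β] (μ : Measure Ω) (G : Ω → β) : Prop :=
  ∀ᵐ p ∂(μ.prod μ), p.1 ≤ p.2 → G p.1 ≤ G p.2

/-- A Markov kernel `κ : Ω → [0,1]` is **stochastically increasing on almost every pair** (w.r.t. `ν`):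
`a ≤ b ⇒ κ_b([0,x]) ≤ κ_a([0,x])` for every `x`, off a `ν ⊗ ν`-null set of pairs `(a, b)`. [this work] -/
def AEPairMonoKernel [Preorder Ω] (ν : Measure Ω) (κ : Kernel Ω I) : Prop :=
  ∀ᵐ p ∂(ν.prod ν), p.1 ≤ p.2 → ∀ x : I, κ p.2 (Iic x) ≤ κ p.1 (Iic x)

variable [Preorder Ω] [Preorder β] [Preorder γ] {μ : Measure Ω}

/-- A monotone map is monotone on almost every pair. [folklore] -/
theorem AEPairMono.of_monotone {G : Ω → β} (hG : Monotone G) : AEPairMono μ G :=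
  ae_of_all _ fun _ hp => hG hp

/-- A map monotone on a set of full measure is monotone on almost every pair. [folklore] -/
theorem AEPairMono.of_monotoneOn [SFinite μ] {G : Ω → β} {S : Set Ω} (hS : ∀ᵐ x ∂μ, x ∈ S)
    (hG : MonotoneOn G S) : AEPairMono μ G := by
  filter_upwards [ae_prod_fst_mem (ν := μ) hS, ae_prod_snd_mem (μ := μ) hS] with p h1 h2 hp using hG h1 h2 hp

/-- Post-composition with a monotone map. [folklore] -/
theorem AEPairMono.monotone_comp {G : Ω → β} (h : AEPairMono μ G) {g : β → γ} (hg : Monotone g) :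
    AEPairMono μ (g ∘ G) := by
  filter_upwards [h] with p hp hle using hg (hp hle)

/-- Almost-every-pair monotonicity only depends on the map up to `μ`-a.e. equality. [folklore] -/
theorem AEPairMono.congr_ae [SFinite μ] {G G' : Ω → β} (h : AEPairMono μ G) (hGG' : G =ᵐ[μ] G') :
    AEPairMono μ G' := by
  have h1 : ∀ᵐ p ∂(μ.prod μ), G p.1 = G' p.1 := ae_prod_fst_mem (ν := μ) (S := {x | G x = G' x}) hGG'
  have h2 : ∀ᵐ p ∂(μ.prod μ), G p.2 = G' p.2 := ae_prod_snd_mem (μ := μ) (S := {x | G x = G' x}) hGG'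
  filter_upwards [h, h1, h2] with p hp hp1 hp2 hle
  rw [← hp1, ← hp2]; exact hp hle

/-- An everywhere stochastically increasing kernel is so on almost every pair. [folklore] -/
theorem AEPairMonoKernel.of_forall {ν : Measure Ω} {κ : Kernel Ω I}
    (hκ : ∀ ⦃a b : Ω⦄, a ≤ b → ∀ x : I, κ b (Iic x) ≤ κ a (Iic x)) : AEPairMonoKernel ν κ :=
  ae_of_all _ fun _ hp => hκ hp

/-- A kernel stochastically increasing on a set of full measure (the form produced by
`SahiBoxTP2Kernel.exists_aeCisKernel`) is so on almost every pair. [folklore] -/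
theorem AEPairMonoKernel.of_monotoneOn {ν : Measure Ω} [SFinite ν] {κ : Kernel Ω I} {T : Set Ω}
    (hT : ∀ᵐ a ∂ν, a ∈ T) (hκ : ∀ ⦃a b : Ω⦄, a ∈ T → b ∈ T → a ≤ b → ∀ x : I, κ b (Iic x) ≤ κ a (Iic x)) :
    AEPairMonoKernel ν κ := by
  filter_upwards [ae_prod_fst_mem (ν := ν) hT, ae_prod_snd_mem (μ := ν) hT] with p h1 h2 hp using hκ h1 h2 hp

/-- Almost-every-pair stochastic monotonicity only depends on the kernel up to `ν`-a.e. equality (it is a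
property of the disintegrated MEASURE, not of the version). [this work] -/
theorem AEPairMonoKernel.congr_ae {ν : Measure Ω} [SFinite ν] {κ η : Kernel Ω I} (h : AEPairMonoKernel ν κ)
    (hκη : ∀ᵐ a ∂ν, κ a = η a) : AEPairMonoKernel ν η := by
  have h1 : ∀ᵐ p ∂(ν.prod ν), κ p.1 = η p.1 := ae_prod_fst_mem (ν := ν) (S := {a | κ a = η a}) hκη
  have h2 : ∀ᵐ p ∂(ν.prod ν), κ p.2 = η p.2 := ae_prod_snd_mem (μ := ν) (S := {a | κ a = η a}) hκη
  filter_upwards [h, h1, h2] with p hp hp1 hp2 hle x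
  rw [← hp1, ← hp2]; exact hp hle x

end Defs

/-! ### CIS in the almost-everywhere kernel sense on the unit cube -/

section CIS

/-- **CIS in the a.e.-kernel sense** for a finite measure on `Q_d = (Fin d → [0,1])`, by recursion on `d`: nothing
in dimension `0`; in dimension `d + 1`, the law `μ^{(d)}` of the first `d` coordinates is `IsCISae d` and the last
coordinate admits a Markov disintegration kernel `κ` over it (`μ^{(d)} ⊗ₘ κ =` law of `((x_0,…,x_{d−1}), x_d)`)
that is stochastically increasing on `μ^{(d)} ⊗ μ^{(d)}`-almost every comparable pair. [this work] -/
def IsCISae : (d : ℕ) → Measure (Fin d → I) → Prop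
  | 0, _ => True
  | d + 1, μ => IsCISae d (μ.map initLast).fst ∧
      ∃ κ : Kernel (Fin d → I) I, IsMarkovKernel κ ∧ (μ.map initLast).fst ⊗ₘ κ = μ.map initLast ∧
        AEPairMonoKernel (μ.map initLast).fst κ

variable {d : ℕ}

/-- Every measure on `Q_0` is `IsCISae 0`. [this work] -/
@[simp] theorem isCISae_zero (μ : Measure (Fin 0 → I)) : IsCISae 0 μ := trivial

/-- Unfolding of `IsCISae (d+1)`. [this work] -/
theorem isCISae_succ_iff (μ : Measure (Fin (d + 1) → I)) :
    IsCISae (d + 1) μ ↔ IsCISae d (μ.map initLast).fst ∧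
      ∃ κ : Kernel (Fin d → I) I, IsMarkovKernel κ ∧ (μ.map initLast).fst ⊗ₘ κ = μ.map initLast ∧
        AEPairMonoKernel (μ.map initLast).fst κ := Iff.rfl

/-- The first `d` coordinates of an `IsCISae (d+1)` law are `IsCISae d`. [this work] -/
theorem IsCISae.fst_initLast {μ : Measure (Fin (d + 1) → I)} (h : IsCISae (d + 1) μ) :
    IsCISae d (μ.map initLast).fst := h.1

/-- **`IsCISae` via the canonical conditional kernel**: for a finite measure on `Q_{d+1}`, `IsCISae (d+1) μ` iff the
first `d` coordinates are `IsCISae d` and Mathlib's disintegration kernel `(μ.map initLast).condKernel` of the last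
coordinate is stochastically increasing on almost every pair (disintegration kernels agree a.e.). [this work] -/
theorem isCISae_succ_iff_condKernel (μ : Measure (Fin (d + 1) → I)) [IsFiniteMeasure μ] :
    IsCISae (d + 1) μ ↔ IsCISae d (μ.map initLast).fst ∧
      AEPairMonoKernel (μ.map initLast).fst (μ.map initLast).condKernel := by
  haveI : IsFiniteMeasure (μ.map initLast) := Measure.isFiniteMeasure_map μ _
  constructor
  · rintro ⟨h1, κ, hκM, hdis, hmono⟩
    refine ⟨h1, hmono.congr_ae ?_⟩
    exact eq_condKernel_of_measure_eq_compProd κ hdis.symm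
  · rintro ⟨h1, hmono⟩
    exact ⟨h1, (μ.map initLast).condKernel, inferInstance, (μ.map initLast).disintegrate _, hmono⟩

/-- **Appending a coordinate through a stochastically increasing kernel**: if the first `d` coordinates of `μ` are
`IsCISae d` and SOME Markov disintegration kernel of the last coordinate is stochastically increasing on almost every
pair, then `μ` is `IsCISae (d+1)`. [this work] -/
theorem isCISae_succ_of_kernel {μ : Measure (Fin (d + 1) → I)} (h1 : IsCISae d (μ.map initLast).fst)
    (κ : Kernel (Fin d → I) I) [IsMarkovKernel κ] (hdis : (μ.map initLast).fst ⊗ₘ κ = μ.map initLast)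
    (hmono : AEPairMonoKernel (μ.map initLast).fst κ) : IsCISae (d + 1) μ :=
  ⟨h1, κ, inferInstance, hdis, hmono⟩

/-- **Box-TP₂ laws are CIS in the a.e.-kernel sense** (every `d`): the Besicovitch conditional kernel of
`SahiBoxTP2Kernel.exists_aeCisKernel` is stochastically increasing on a set of full measure, and box-TP₂ descends to
the first `d` coordinates.  (MTP₂ ⇒ CI is Karlin–Rinott / Müller–Stoyan Thm. 3.10.16 for densities; this is the
singular-law form.) [this work] -/
theorem _root_.Summit.CriticalPhenomena.PercolationContinuityZ3.Theorems.SahiBoxTP2.IsBoxTP2.isCISae :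
    ∀ (d : ℕ) (μ : Measure (Fin d → I)) [IsProbabilityMeasure μ], IsBoxTP2 μ → IsCISae d μ := by
  intro d
  induction d with
  | zero => intro μ _ _; trivial
  | succ d ih =>
    intro μ _ hμ
    refine ⟨ih _ hμ.fst_initLast, ?_⟩
    obtain ⟨κ, hκM, hdis, T, hT, hκmono⟩ := exists_aeCisKernel hμ.isBallTP2Cut_lawInitLastReal
    rw [fst_lawInitLastReal] at hdis hT
    have hproj : Measurable (projIcc (0 : ℝ) 1 zero_le_one) := continuous_projIcc.measurable
    haveI := Kernel.IsMarkovKernel.map κ hproj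
    refine ⟨κ.map (projIcc (0 : ℝ) 1 zero_le_one), inferInstance, compProd_map_projIcc_eq (μ.map initLast) κ hdis,
      AEPairMonoKernel.of_monotoneOn hT fun a b ha hb hab y => map_projIcc_Iic_le κ (hκmono ha hb hab) y⟩

end CIS

/-! ### The standard construction, almost-every-pair version -/

section Step

variable {d : ℕ}

/-- Lebesgue measure on `Q_{d+1}` splits as `λ ⊗ λ_d` under `x ↦ (x_d, (x_0,…,x_{d−1}))`. [folklore] -/
theorem volume_map_splitLast :
    (volume : Measure (Fin (d + 1) → I)).map (splitLast d) = (volume : Measure I).prod volume :=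
  (volume_preserving_piFinSuccAbove (fun _ : Fin (d + 1) => I) (Fin.last d)).map_eq

/-- The first-`d`-coordinates map `x ↦ (x_0,…,x_{d−1})` pushes `λ_{d+1}` to `λ_d`. [folklore] -/
theorem volume_map_snd_splitLast :
    (volume : Measure (Fin (d + 1) → I)).map (fun x => (splitLast d x).2) = volume := by
  rw [show (fun x : Fin (d + 1) → I => (splitLast d x).2) = Prod.snd ∘ splitLast d from rfl,
    ← Measure.map_map measurable_snd (splitLast d).measurable, volume_map_splitLast, Measure.map_snd_prod,
    measure_univ, one_smul]

/-- A pair statement holding for `λ_d ⊗ λ_d`-a.e. pair of first-`d`-coordinate vectors holds for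
`λ_{d+1} ⊗ λ_{d+1}`-a.e. pair of points of `Q_{d+1}`. [folklore] -/
theorem ae_prod_of_ae_prod_snd_splitLast {P : (Fin d → I) × (Fin d → I) → Prop}
    (h : ∀ᵐ q ∂((volume : Measure (Fin d → I)).prod volume), P q) :
    ∀ᵐ p ∂((volume : Measure (Fin (d + 1) → I)).prod volume), P ((splitLast d p.1).2, (splitLast d p.2).2) := by
  have hf : Measurable fun x : Fin (d + 1) → I => (splitLast d x).2 := measurable_snd.comp (splitLast d).measurable
  have h' : ∀ᵐ q ∂(((volume : Measure (Fin (d + 1) → I)).map fun x => (splitLast d x).2).prod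
      ((volume : Measure (Fin (d + 1) → I)).map fun x => (splitLast d x).2)), P q := by
    rwa [volume_map_snd_splitLast]
  exact ae_prod_comp_of_ae_prod_map hf hf h'

/-- **The standard construction, one almost-every-pair step.** If `G : Q_d → α` is measurable and monotone on
`λ_d`-almost every pair, and `κ : α → [0,1]` is a Markov kernel stochastically increasing on `G_*λ_d`-almost every
pair, then `x ↦ (G x', q_{κ(G x')}(x_d))` (`x'` the first `d` coordinates, `q` the fibrewise quantile) is measurable,
monotone on `λ_{d+1}`-almost every pair, and pushes `λ_{d+1}` to `(G_* λ_d) ⊗ₘ κ`. [this work] -/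
theorem exists_aepairmono_map_compProd {α : Type*} [MeasurableSpace α] [Preorder α] {G : (Fin d → I) → α}
    (hGm : Measurable G) (hG : AEPairMono volume G) (κ : Kernel α I) [IsMarkovKernel κ]
    (hκ : AEPairMonoKernel ((volume : Measure (Fin d → I)).map G) κ) :
    ∃ G' : (Fin (d + 1) → I) → α × I, Measurable G' ∧ AEPairMono volume G' ∧
      (volume : Measure (Fin (d + 1) → I)).map G' = ((volume : Measure (Fin d → I)).map G) ⊗ₘ κ := by
  set e := splitLast d with he
  set Ψ : I × (Fin d → I) → α × I := fun q => (G q.2, KernelQuantile.kq κ (G q.2, q.1)) with hΨ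
  have hstep : Measurable fun p : α × I => (p.1, KernelQuantile.kq κ p) :=
    measurable_fst.prodMk (KernelQuantile.measurable_kq κ)
  have hGid : Measurable (Prod.map G (id : I → I)) := hGm.prodMap measurable_id
  have hΨeq : Ψ = ((fun p : α × I => (p.1, KernelQuantile.kq κ p)) ∘ Prod.map G id) ∘ Prod.swap := by
    funext q; rfl
  have hΨm : Measurable Ψ := by
    rw [hΨeq]; exact (hstep.comp hGid).comp measurable_swap
  -- the good pairs of first-`d`-coordinate vectors
  have hκ' : ∀ᵐ q ∂((volume : Measure (Fin d → I)).prod volume),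
      G q.1 ≤ G q.2 → ∀ x : I, κ (G q.2) (Iic x) ≤ κ (G q.1) (Iic x) :=
    ae_prod_comp_of_ae_prod_map (P := fun r : α × α => r.1 ≤ r.2 → ∀ x : I, κ r.2 (Iic x) ≤ κ r.1 (Iic x))
      hGm hGm hκ
  have hgood : ∀ᵐ q ∂((volume : Measure (Fin d → I)).prod volume),
      q.1 ≤ q.2 → G q.1 ≤ G q.2 ∧ ∀ x : I, κ (G q.2) (Iic x) ≤ κ (G q.1) (Iic x) := by
    filter_upwards [hG, hκ'] with q h1 h2 hle using ⟨h1 hle, h2 (h1 hle)⟩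
  refine ⟨Ψ ∘ e, hΨm.comp e.measurable, ?_, ?_⟩
  · have hlift := ae_prod_of_ae_prod_snd_splitLast hgood
    filter_upwards [hlift] with p hp hle
    have hexy : e p.1 ≤ e p.2 := splitLast_mono hle
    obtain ⟨hG2, hk⟩ := hp hexy.2
    refine ⟨hG2, ?_⟩
    change KernelQuantile.kq κ (G (e p.1).2, (e p.1).1) ≤ KernelQuantile.kq κ (G (e p.2).2, (e p.2).1)
    rw [KernelQuantile.kq_apply, KernelQuantile.kq_apply]
    exact (UnitIntervalQuantile.quantile_mono (κ (G (e p.1).2)) hexy.1).trans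
      (UnitIntervalQuantile.quantile_mono_measure _ _ hk _)
  · rw [← Measure.map_map hΨm e.measurable, volume_map_splitLast, hΨeq,
      ← Measure.map_map (hstep.comp hGid) measurable_swap, Measure.prod_swap, ← Measure.map_map hstep hGid,
      ← Measure.map_prod_map _ _ hGm measurable_id, Measure.map_id, KernelQuantile.map_prod_kq]

end Step

/-! ### The coupling theorem -/

section Coupling

/-- **THE STANDARD CONSTRUCTION (a.e.-pair form).** Every `IsCISae` probability law `μ` on `Q_d` (every `d`) is
`G_* λ_d` for a Borel map `G : Q_d → Q_d` monotone on `λ_d ⊗ λ_d`-almost every comparable pair.  (Induction on `d`: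
split off the last coordinate, couple the first `d` coordinates, append the fibrewise quantile of the a.e.-pair
stochastically increasing kernel.)  The companion `SahiCISMonotoneVersion.lean` replaces `G` by an
everywhere-monotone Borel map with the same push-forward. [this work] -/
theorem IsCISae.exists_aepairmono_coupling (d : ℕ) :
    ∀ (μ : Measure (Fin d → I)) [IsProbabilityMeasure μ], IsCISae d μ →
      ∃ G : (Fin d → I) → (Fin d → I), Measurable G ∧ AEPairMono volume G ∧
        (volume : Measure (Fin d → I)).map G = μ := by
  induction d with
  | zero =>
    intro μ _ _
    refine ⟨id, measurable_id, AEPairMono.of_monotone monotone_id, ?_⟩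
    rw [Measure.map_id]
    ext s hs
    by_cases hne : s.Nonempty
    · rw [Subsingleton.eq_univ_of_nonempty hne, measure_univ, measure_univ]
    · rw [not_nonempty_iff_eq_empty.1 hne, measure_empty, measure_empty]
  | succ d ih =>
    intro μ _ hμ
    obtain ⟨h1, κ, hκM, hdis, hκmono⟩ := hμ
    obtain ⟨G, hGm, hG, hGν⟩ := ih (μ.map initLast).fst h1
    rw [← hGν] at hκmono
    obtain ⟨G', hG'm, hG'mono, hG'eq⟩ := exists_aepairmono_map_compProd hGm hG κ hκmono
    have hsw : Measurable fun p : (Fin d → I) × I => (splitLast d).symm (p.2, p.1) :=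
      (splitLast d).symm.measurable.comp measurable_swap
    have hswm : Monotone fun p : (Fin d → I) × I => (splitLast d).symm (p.2, p.1) := fun p q hpq =>
      splitLast_symm_mono (d := d) (show (p.2, p.1) ≤ (q.2, q.1) from ⟨hpq.2, hpq.1⟩)
    refine ⟨(fun p : (Fin d → I) × I => (splitLast d).symm (p.2, p.1)) ∘ G', hsw.comp hG'm,
      hG'mono.monotone_comp hswm, ?_⟩
    rw [← Measure.map_map hsw hG'm, hG'eq, hGν, hdis, Measure.map_map hsw measurable_initLast]
    convert Measure.map_id (μ := μ) using 2
    funext x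
    exact (splitLast d).symm_apply_apply x

end Coupling

end Summit.CriticalPhenomena.PercolationContinuityZ3.Theorems.SahiCIS

end
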